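import Summits.RiemannHypothesis.RiemannHypothesis.Theorems.TiltedLandingLaw421R3SinkCorner
import Summits.RiemannHypothesis.RiemannHypothesis.Theorems.TiltedLandingLaw421R3SinkEndsKink
import Summits.RiemannHypothesis.RiemannHypothesis.Theorems.TiltedLandingLaw421R3SinkMirror

/-!
# «SinkCertLink» v2 — the last arrow «C′ ⇒ `CertificatesExistRightSig`» of the K-programme, with its two residuals TYPED
(C4 «kernel desk», rh-idea-6 g44; files-only; SUPPORT, (K)+(D) bookkeeping only; consumer named by director-rh (CA1049):
«the `CertificatesExistRightSig` ⇐ Ends ∧ Kink real certificates link over #1276/#1277»; token 142; v2 = v1 bafe0975 with the ONE rename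
`datumAlt_realTwoPoint_iff` → `datumAlt_realTwoPoint_forall_mult_iff` ruled in (CA1056) — DECL-HOME of the (D) closed form = this file; nothing else moved)

THREE imports, all TREE (link-file multi-import as ruled for C3's lids, (CA1023)(3)): 118 «SinkCorner» (#1276; carries 107 «SinkCompose» #1259,
the Literature maximum principle through «SinkLemmaH», 113 «CornerReduction» #1266 and 102 «SinkTemplate» #1255), 119 «SinkEndsKink» (#1277; the real
closed forms over 109 «SinkBdry» #1261) and 117 «SinkMirror» (#1269; `CertificatesExistRightSig`, the reflection to 102's `CertificatesExistSig`).
Namespace `RhW08.SinkCertLink`; nothing re-declared.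

WHAT THE TREE HAD.  113/119: `CornerDominanceRSig ↔ CornerDominanceEndsRSig ∧ CornerDominanceKinkRSig ↔ (real closed forms)` — boundary domination (K∂)
of the real-part two-point family `realTwoPoint xv h y0 w` at `σ* = cornerSigma …` for RIGHT CONE children, all weights `y0 ∈ [0,1]`; 118: (K∂) ∘ 107 ⇒
`Lcert … σ* ≤ L`.  117: `CertificatesExistRightSig lam → CertificatesExistSig lam`; #1280 «SinkFeedLid»: `CertificatesExistSig lam` ⇒ the sink
inequality at band children on the whole box.  MISSING between them: the arrow INTO `CertificatesExistRightSig lam`, which asks, per right datum, for an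
admissible family on the two axis points with (K) on the WHOLE maximal strip AND the datum alternative (D).

WHAT THIS FILE DOES.
* §1 (D) FOR THE TWO-POINT FAMILY IN CLOSED FORM (PROVED): both cuts read direction `−1` and the weights sum to `1`, so
  `Lcert (realTwoPoint xv h y0 w) G σ = −Re G + σ·Im G` (`lcert_realTwoPoint`) — `y0` enters ONLY through `σ*(y0)`; at the read value
  `G = −mult·K`, `K = farPairK v w`: `Lcert = mult·(Re K − σ·Im K)` (`lcert_realTwoPoint_neg_mul`); and (D) for every multiplicity `mult ≥ 1` is
  EQUIVALENT to the one real alternative `‖K‖/lam ≤ Re K − σ·Im K ∨ 1/(2s) < Re K − σ·Im K` (`datumAlt_realTwoPoint_forall_mult_iff`, `0 < lam`; both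
  disjuncts force the bracket `≥ 0`, so `mult = 1` is the worst case).
* §2 THE TWO RESIDUALS, TYPED (conjecture-shaped `def`s; binders = 117's `CertificatesExistRightSig` :159 VERBATIM + one case literal; NO content
  claimed, NO certificate, NO regime statement):
  `DatumConeRSig lam` — for every right CONE datum some weight `y0 ∈ [0,1]` satisfies (D) for the two-point family at `σ*(y0)` (the (D) side of 102,
  stated by no tree decl before); `CertificatesNonConeRSig lam` — 117's body under the extra binder `¬ ConeChild xv R w`: the children OUTSIDE the
  whole corner-dominance programme (they exist in scope, e.g. `s = 1, h = Im v = 2, R = 6.5, Im w = 1.8, Re w − xv = 0.8`: `0.8·5.7 = 4.56 > 3.24`;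
  102 §5's rule R1 / a third cut is where their certificate must come from).
* §3 THE LINK (PROVED): `certificatesExistRightSig_of_cornerDominanceR : CornerDominanceRSig → DatumConeRSig lam → CertificatesNonConeRSig lam →
  CertificatesExistRightSig lam` — case split on `ConeChild`; cone case: the family `realTwoPoint xv h y0 w` with the `y0` of (D), admissible by 118's
  `realTwoPoint_admissible`, points clause by `Fin 2` cases, (K) on the WHOLE strip = «SinkLemmaH».`sinkLemmaH` ∘ `CornerDominanceRSig` at that `y0`
  (child in the near window by 118's `abs_re_lt_of_nested`, cut points on the axis by admissibility, frame binder `6s ≤ R` from `2s ≤ h ∧ 3h < R`);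
  then `…_of_parts` (from `CornerDominanceEndsRSig ∧ CornerDominanceKinkRSig`, 113's K-link), `…_of_real` (from 119's REAL closed forms — the shape
  C3's `BdryDomForm` certificates feed), and the two-sided `certificatesExistSig_of_parts / _of_real` (∘ 117's reflection).  AFTER THIS FILE exactly
  {`CornerDominanceEndsRRealSig` (K0 ∧ K1), `CornerDominanceKinkRRealSig`, `DatumConeRSig lam`, `CertificatesNonConeRSig lam`} stand typed between the
  tree and 102's `CertificatesExistSig lam`, hence (#1280 ★3ℓ) the sink inequality `‖farFieldAt f j v w‖ ≤ lam·η/s` on the whole box.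
LEVEL: SUPPORT.  Asserts no law (the four statements enter as HYPOTHESES).  No `sorry`.  Nothing here bears on the truth of RH; RH is not proved;
⟨33346⟩/⟨33347⟩ OPEN; `CornerDominance*RSig` / `DatumConeRSig` / `CertificatesNonConeRSig` / `CertificatesExistSig` OPEN; checked ≠ keyed ≠ landed ≠ proved.
-/

noncomputable section

open Complex
open scoped ComplexConjugate
open RhW08.SinkTemplate RhW08.SinkCornerReduction RhW08.SinkCorner RhW08.SinkEndsKink RhW08.SinkMirror

namespace RhW08.SinkCertLink

/-! ## §1 (D) for the real-part two-point family in closed form -/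

/-- the two reading points of `realTwoPoint xv h y0 w` are the foot `xv + i·Im w` and the box top `xv + i·h`. -/
theorem realTwoPoint_pts (xv h y0 : ℝ) (w : ℂ) :
    ∀ k, (realTwoPoint xv h y0 w k).p = ⟨xv, w.im⟩ ∨ (realTwoPoint xv h y0 w k).p = ⟨xv, h⟩ :=
  Fin.forall_fin_two.2 ⟨Or.inl rfl, Or.inr rfl⟩

/-- the certified level of the two-point family is `y0`-FREE except through `σ`: `Lcert (realTwoPoint xv h y0 w) G σ = −Re G + σ·Im G`
(both cuts read direction `−1`, the weights `y0 + (1 − y0) = 1`). -/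
theorem lcert_realTwoPoint (xv h y0 : ℝ) (w G : ℂ) (σ : ℝ) :
    Lcert (realTwoPoint xv h y0 w) G σ = -G.re + σ * G.im := by
  unfold Lcert realTwoPoint
  rw [Fin.sum_univ_two]
  simp only [Matrix.cons_val_zero, Matrix.cons_val_one, map_neg, map_one, neg_mul, one_mul, neg_re]
  ring

/-- … at the read value `G = −mult·K`: `Lcert = mult·(Re K − σ·Im K)`. -/
theorem lcert_realTwoPoint_neg_mul (xv h y0 : ℝ) (w K : ℂ) (mult : ℕ) (σ : ℝ) :
    Lcert (realTwoPoint xv h y0 w) (-((mult : ℂ) * K)) σ = mult * (K.re - σ * K.im) := by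
  rw [lcert_realTwoPoint]
  simp only [neg_re, neg_im, neg_neg, mul_re, mul_im, natCast_re, natCast_im, zero_mul, sub_zero, add_zero]
  ring

/-- (D) FOR THE TWO-POINT FAMILY ⇔ ONE REAL ALTERNATIVE (`0 < lam`, `0 < s` — both in the sink's scope; for `s < 0` the equivalence FAILS): the datum
alternative at the read value `−mult·K` for EVERY multiplicity `mult ≥ 1` holds iff `‖K‖/lam ≤ Re K − σ·Im K ∨ 1/(2s) < Re K − σ·Im K` (the case
`mult = 1`; either disjunct makes the bracket positive resp. nonnegative, and then `mult·bracket ≥ bracket`).  `gnorm = ‖K‖` is the one-copy modulus, as in 102/117. -/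
theorem datumAlt_realTwoPoint_forall_mult_iff {lam s : ℝ} (hlam : 0 < lam) (hs : 0 < s) (xv h y0 σ : ℝ) (w K : ℂ) :
    (∀ mult : ℕ, 1 ≤ mult → DatumAlt lam s ‖K‖ (realTwoPoint xv h y0 w) (-((mult : ℂ) * K)) σ) ↔
      (‖K‖ / lam ≤ K.re - σ * K.im ∨ 1 / (2 * s) < K.re - σ * K.im) := by
  constructor
  · intro h
    have h1 := h 1 le_rfl
    unfold DatumAlt at h1
    rwa [lcert_realTwoPoint_neg_mul, Nat.cast_one, one_mul] at h1
  · intro h mult hmult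
    unfold DatumAlt
    rw [lcert_realTwoPoint_neg_mul]
    have hm : (1 : ℝ) ≤ mult := by exact_mod_cast hmult
    have hK0 : 0 ≤ ‖K‖ / lam := div_nonneg (norm_nonneg K) hlam.le
    rcases h with h | h
    · left
      have hB : 0 ≤ K.re - σ * K.im := hK0.trans h
      nlinarith
    · right
      have h2s : 0 < 1 / (2 * s) := by positivity
      have hB : 0 < K.re - σ * K.im := h2s.trans h
      nlinarith

/-! ## §2 The two residuals of the K-programme, typed -/

/-- (D)-CONE RESIDUAL (OPEN; conjecture-shaped; the (D) side of 102's template for the real-part two-point family): for every RIGHT CONE datum of 117's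
`CertificatesExistRightSig lam` (its binders verbatim, plus `ConeChild xv R w`) SOME weight `y0 ∈ [0, 1]` satisfies the datum alternative (D) for
`realTwoPoint xv h y0 w` at `σ* = cornerSigma …` and the read value `−mult·farPairK v w`.  By `datumAlt_realTwoPoint_forall_mult_iff` the target per datum is the
one real alternative `‖K‖/lam ≤ Re K − σ*(y0)·Im K ∨ 1/(2s) < Re K − σ*(y0)·Im K`, `K = farPairK v w`.  NO certificate is claimed here. -/
def DatumConeRSig (lam : ℝ) : Prop :=
  ∀ (xv R s h : ℝ) (v w : ℂ) (mult : ℕ),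
    0 < s → 2 * s ≤ h → 3 * h < R → v.re = xv → 0 < v.im → v.im ≤ h →
    0 < w.im → w.im < v.im → v.im - s / 4 < w.im → (w.re - xv) ^ 2 + w.im ^ 2 ≤ v.im ^ 2 → 1 ≤ mult → xv ≤ w.re →
    ConeChild xv R w →
    ∃ y0 : ℝ, 0 ≤ y0 ∧ y0 ≤ 1 ∧
      DatumAlt lam s ‖farPairK v w‖ (realTwoPoint xv h y0 w) (-((mult : ℂ) * farPairK v w))
        (cornerSigma xv R (realTwoPoint xv h y0 w) w)

/-- NON-CONE RESIDUAL (OPEN; conjecture-shaped): 117's `CertificatesExistRightSig lam` restricted to the right children OUTSIDE the cone window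
`|Re w − xv|·(R − |Re w − xv|) < (Im w)²` — the data the corner-dominance programme (102 §4, 113, 118, 119) does not address at all (there `c(u)` changes
sign on the maximal strip, #1279 «SinkConePos»); typed as the honest complement, NO content claimed. -/
def CertificatesNonConeRSig (lam : ℝ) : Prop :=
  ∀ (xv R s h : ℝ) (v w : ℂ) (mult : ℕ),
    0 < s → 2 * s ≤ h → 3 * h < R → v.re = xv → 0 < v.im → v.im ≤ h →
    0 < w.im → w.im < v.im → v.im - s / 4 < w.im → (w.re - xv) ^ 2 + w.im ^ 2 ≤ v.im ^ 2 → 1 ≤ mult → xv ≤ w.re →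
    ¬ ConeChild xv R w →
    ∃ (n : ℕ) (cs : Fin n → Cut) (σ : ℝ), CutsAdmissible xv cs ∧ (∀ k, (cs k).p = ⟨xv, w.im⟩ ∨ (cs k).p = ⟨xv, h⟩) ∧
      KernelDom xv R cs w σ ∧
      DatumAlt lam s ‖farPairK v w‖ cs (-((mult : ℂ) * farPairK v w)) σ

/-- THE NON-CONE RESIDUAL IS NOT VACUOUS: a right datum meeting every binder of 117's `CertificatesExistRightSig` that is NOT a cone child
(`xv = 0, R = 13/2, s = 1, h = 2, v = 2i, w = 4/5 + 9i/5`: `(4/5)·(13/2 − 4/5) = 114/25 ≥ (9/5)² = 81/25`). -/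
theorem nonCone_rightDatum_exists :
    ∃ (xv R s h : ℝ) (v w : ℂ), 0 < s ∧ 2 * s ≤ h ∧ 3 * h < R ∧ v.re = xv ∧ 0 < v.im ∧ v.im ≤ h ∧
      0 < w.im ∧ w.im < v.im ∧ v.im - s / 4 < w.im ∧ (w.re - xv) ^ 2 + w.im ^ 2 ≤ v.im ^ 2 ∧ xv ≤ w.re ∧ ¬ ConeChild xv R w := by
  refine ⟨0, 13 / 2, 1, 2, ⟨0, 2⟩, ⟨4 / 5, 9 / 5⟩, by norm_num, by norm_num, by norm_num, rfl, by norm_num, by norm_num, by norm_num,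
    by norm_num, by norm_num, by norm_num, by norm_num, ?_⟩
  unfold ConeChild
  rw [sub_zero, abs_of_pos (by norm_num : (0 : ℝ) < 4 / 5)]
  norm_num

/-- … while CONE right data exist too (`xv = 0, R = 13/2, s = 1, h = 2, v = 2i, w = 19i/10`), so the case split of the link is genuine. -/
theorem cone_rightDatum_exists :
    ∃ (xv R s h : ℝ) (v w : ℂ), 0 < s ∧ 2 * s ≤ h ∧ 3 * h < R ∧ v.re = xv ∧ 0 < v.im ∧ v.im ≤ h ∧
      0 < w.im ∧ w.im < v.im ∧ v.im - s / 4 < w.im ∧ (w.re - xv) ^ 2 + w.im ^ 2 ≤ v.im ^ 2 ∧ xv ≤ w.re ∧ ConeChild xv R w := by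
  refine ⟨0, 13 / 2, 1, 2, ⟨0, 2⟩, ⟨0, 19 / 10⟩, by norm_num, by norm_num, by norm_num, rfl, by norm_num, by norm_num, by norm_num,
    by norm_num, by norm_num, by norm_num, le_rfl, ?_⟩
  unfold ConeChild
  rw [sub_zero, abs_zero]
  norm_num

/-! ## §3 The link -/

/-- (K) ON THE WHOLE MAXIMAL STRIP for the two-point family at `σ*`, from right-sided corner dominance: «SinkLemmaH» (boundary ⇒ strip; the child sits in
the near window by 118's `abs_re_lt_of_nested`, the cut points on the axis by admissibility) ∘ `CornerDominanceRSig`. -/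
theorem kernelDom_realTwoPoint_of_cornerDominanceR (hCD : CornerDominanceRSig) (xv R s h y0 : ℝ) (v w : ℂ)
    (hs : 0 < s) (hR6 : 6 * s ≤ R) (h3 : 3 * h < R) (hv : v.re = xv) (hY : 0 < v.im) (hYh : v.im ≤ h)
    (ht : 0 < w.im) (htY : w.im < v.im) (hdrop : v.im - s / 4 < w.im) (hnest : (w.re - xv) ^ 2 + w.im ^ 2 ≤ v.im ^ 2)
    (hcone : ConeChild xv R w) (hright : xv ≤ w.re) (hy0 : 0 ≤ y0) (hy1 : y0 ≤ 1) :
    KernelDom xv R (realTwoPoint xv h y0 w) w (cornerSigma xv R (realTwoPoint xv h y0 w) w) := by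
  have hw : |w.re - xv| < R / 2 := abs_re_lt_of_nested h3 hY.le hYh hnest
  have hp : ∀ k, |(realTwoPoint xv h y0 w k).p.re - xv| < R / 2 := fun k => by
    rw [((realTwoPoint_admissible xv h y0 w hy0 hy1).1 k).2.2, sub_self, abs_zero]
    linarith [abs_nonneg (w.re - xv)]
  exact RhW08.SinkLemmaH.sinkLemmaH (Fin 2) xv R (realTwoPoint xv h y0 w) w _ hw hp
    (hCD xv R s h y0 v w hs hR6 h3 hv hY hYh ht htY hdrop hnest hcone hright hy0 hy1)

/-- ★ THE LINK from RIGHT-SIDED CORNER DOMINANCE: `CornerDominanceRSig`, the (D)-cone residual and the non-cone residual give 117's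
`CertificatesExistRightSig lam` (case split on `ConeChild xv R w`; in the cone case the certificate is the two-point family at the weight `y0` of (D)
with `σ = σ*(y0)`). -/
theorem certificatesExistRightSig_of_cornerDominanceR {lam : ℝ} (hCD : CornerDominanceRSig) (hD : DatumConeRSig lam)
    (hN : CertificatesNonConeRSig lam) : CertificatesExistRightSig lam := by
  intro xv R s h v w mult hs hsh h3 hv hY hYh ht htY hdrop hnest hmult hright
  by_cases hcone : ConeChild xv R w
  · obtain ⟨y0, hy0, hy1, hDat⟩ := hD xv R s h v w mult hs hsh h3 hv hY hYh ht htY hdrop hnest hmult hright hcone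
    have hR6 : 6 * s ≤ R := by linarith
    exact ⟨2, realTwoPoint xv h y0 w, cornerSigma xv R (realTwoPoint xv h y0 w) w, realTwoPoint_admissible xv h y0 w hy0 hy1,
      realTwoPoint_pts xv h y0 w,
      kernelDom_realTwoPoint_of_cornerDominanceR hCD xv R s h y0 v w hs hR6 h3 hv hY hYh ht htY hdrop hnest hcone hright hy0 hy1, hDat⟩
  · exact hN xv R s h v w mult hs hsh h3 hv hY hYh ht htY hdrop hnest hmult hright hcone

/-- ★ THE LINK FROM THE PARTS: 113's two restricted conjectures (ends `y0 ∈ {0,1}` and kink weights), the (D)-cone residual and the non-cone residual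
give `CertificatesExistRightSig lam`. -/
theorem certificatesExistRightSig_of_parts {lam : ℝ} (hE : CornerDominanceEndsRSig) (hK : CornerDominanceKinkRSig)
    (hD : DatumConeRSig lam) (hN : CertificatesNonConeRSig lam) : CertificatesExistRightSig lam :=
  certificatesExistRightSig_of_cornerDominanceR (cornerDominanceRSig_of_ends_of_kink hE hK) hD hN

/-- ★ THE LINK FROM THE REAL CLOSED FORMS (119): the shape the `BdryDomForm` certificates of the K-programme feed. -/
theorem certificatesExistRightSig_of_real {lam : ℝ} (hE : CornerDominanceEndsRRealSig) (hK : CornerDominanceKinkRRealSig)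
    (hD : DatumConeRSig lam) (hN : CertificatesNonConeRSig lam) : CertificatesExistRightSig lam :=
  certificatesExistRightSig_of_cornerDominanceR (cornerDominanceRSig_iff_endsReal_and_kinkReal.2 ⟨hE, hK⟩) hD hN

/-- ★ TWO-SIDED: the four parts give 102's `CertificatesExistSig lam` (left children by 117's reflection). -/
theorem certificatesExistSig_of_parts {lam : ℝ} (hE : CornerDominanceEndsRSig) (hK : CornerDominanceKinkRSig)
    (hD : DatumConeRSig lam) (hN : CertificatesNonConeRSig lam) : CertificatesExistSig lam :=
  certificatesExistSig_of_right lam (certificatesExistRightSig_of_parts hE hK hD hN)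

/-- ★ TWO-SIDED, from the real closed forms. -/
theorem certificatesExistSig_of_real {lam : ℝ} (hE : CornerDominanceEndsRRealSig) (hK : CornerDominanceKinkRRealSig)
    (hD : DatumConeRSig lam) (hN : CertificatesNonConeRSig lam) : CertificatesExistSig lam :=
  certificatesExistSig_of_right lam (certificatesExistRightSig_of_real hE hK hD hN)

/-- CONVERSELY the two residuals are CONSEQUENCES of nothing weaker than themselves only in the non-cone part: `CertificatesExistRightSig lam` gives
`CertificatesNonConeRSig lam` back (restriction), so that residual loses nothing. -/
theorem certificatesNonConeRSig_of_right {lam : ℝ} (h : CertificatesExistRightSig lam) : CertificatesNonConeRSig lam :=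
  fun xv R s hh v w mult hs hsh h3 hv hY hYh ht htY hdrop hnest hmult hright _ =>
    h xv R s hh v w mult hs hsh h3 hv hY hYh ht htY hdrop hnest hmult hright

end RhW08.SinkCertLink

end
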